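import Literature.NumberTheory.EllipticCurves.SelmerPInftyRelModelAction
import Literature.NumberTheory.EllipticCurves.LocalRestrictionFiniteDegree
import Literature.NumberTheory.EllipticCurves.ZpCorankCyclotomicDivisibility
import Literature.NumberTheory.EllipticCurves.ZpCorankQuasiIso
import Literature.NumberTheory.EllipticCurves.PeriodIndexCorestriction
import Literature.NumberTheory.EllipticCurves.IwasawaSelmerProofs
import Literature.NumberTheory.EllipticCurves.SelmerCorankAssembly
import Literature.NumberTheory.EllipticCurves.BSDSelmerParityDokchitserHeegnerFieldProofs
import Literature.NumberTheory.EllipticCurves.ZpExtensionAnticyclotomicHoldsProofs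
import Mathlib.GroupTheory.SpecificGroups.Cyclic.Basic
import Mathlib.GroupTheory.Sylow
import HarnessLib

/-!
# `rk_p(E/F) ≡ rk_p(E/K) (mod p − 1)` for a Galois extension `F/K` of prime degree `p` (Dokchitser–Dokchitser 2010, Cor. 4.15)

For an elliptic curve `E = W` over a number field `K` and a prime `p`, this file proves

* `selmerCorank_eq_zpCorank_selmerModelInvariants` — **Lemma 4.14 of Dokchitser–Dokchitser**,
  Ann. of Math. 172 (2010), p. 23 (arXiv Lemma 47): "Let `E/K` be an elliptic curve, and let
  `F/K` be a finite Galois extension with Galois group `G`. Then `rk_p(E/K) = dim_{ℚ_p} X_p(E/F)^G`",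
  on the Selmer side: for **any finite Galois `F/K`** and any prime `p`,
  `rk_p(E/K) = corank_{ℤ_p} (T^G)`, where `T ≅ Sel_{p^∞}(E_F/F)` is the model of the Selmer group
  of `E` over `F` inside `H¹(Gal(K̄/F), E[p^∞])` (`selmerModel`) and `T^G` its subgroup of classes
  fixed by the conjugation action of every `g ∈ Γ_K` (`selmerModelInvariants`); the restriction
  `Sel_{p^∞}(E/K) → T^G` has kernel killed by `|G|` and cokernel killed by `|G| · B(|G|)`
  (printed: "kernel and cokernel killed by `|G|²`"; only boundedness matters for coranks);

and, for an odd prime `p` and a **Galois extension `F/K` of degree `p`**,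

* `exists_selmerCorank_baseChange_eq_add_of_prime_degree` —
  `rk_p(E/F) = rk_p(E/K) + (p - 1) k` for some `k : ℕ`
  (`rk_p = corank_{ℤ_p} Sel_{p^∞} = WeierstrassCurve.selmerCorank`), and hence
* `selmerCorank_baseChange_mod_two_eq_of_prime_degree` — **Cor. 4.15 of Dokchitser–Dokchitser**,
  Ann. of Math. 172 (2010), p. 24 (arXiv Cor. 48): "the parity of the `p^∞`-Selmer rank is
  unchanged in cyclic `p`-extensions", in the degree-`p` form in which it is deduced there from
  Lemma 4.14 and the sentence "A cyclic group of order `p` has only two `ℚ_p`-irreducible `p`-adic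
  representations, the trivial one and one of dimension `p - 1`. Thus," (`rk_p(E/F) - rk_p(E/K)`
  is a multiple of `p - 1`, even for `p` odd); this is *verbatim the hypothesis `h415`* of the
  tree's reduction `dokchitser_selmerCorank_baseChange_mod_two_eq_of_printed`
  (file `BSDSelmerParityDokchitserHeegnerFieldProofs`), which is thereby discharged:
* `selmerCorank_baseChange_mod_two_eq_of_isCyclic` — **Cor. 4.15 as printed** ("cyclic
  `p`-extensions"): for `F/K` Galois with cyclic Galois group of order `p^(n+1)`, `p` odd,
  `rk_p(E/F) ≡ rk_p(E/K) (mod 2)`, by induction along the tower `K ⊂ F^H ⊂ F`, `|H| = p^n`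
  (`Sylow.exists_subgroup_card_pow_prime`, `IntermediateField.finrank_fixedField_eq_card`,
  `IsGalois.of_fixedField_normal_subgroup`, `baseChange_baseChange`) from the degree-`p` case;
* `dokchitser_selmerCorank_baseChange_mod_two_eq_of_h417_of_hCV` — step (4) of the proof of
  Thm. 4.19 (= Thm. 1.4), the named fact `dokchitser_selmerCorank_baseChange_mod_two_eq`
  ("`rk_p(E/M₀)` is odd"), now from the two remaining printed inputs only: the dihedral
  congruence `h417` (Prop. 4.17 + "`C(E/F)`, `C(E/M)` are squares") and Cornut–Vatsal /
  Nekovář `hCV` ("`m_ρ = p^n` for `n` large"); the anticyclotomic tower (`hanti`) was discharged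
  in `ZpExtensionAnticyclotomicHoldsProofs`, Cor. 4.15 (`h415`) is discharged here.

## The proofs (D–D, proof of Lemma 4.14 and of Cor. 4.15, pp. 23–24)

Write `G = Γ_K`, `N = galRange F ◁ G` (the absolute Galois group of the copy of `F` in `K̄`;
normal of index `d = [F : K]`, `RelModel.index_galRange`, `RelModel.normal_galRange`),
`M = E[p^∞](K̄)`, `S = Sel_{p^∞}(E/K) ⊆ H¹(G, M)` and `T ⊆ H¹(N, M)` the image of
`Sel_{p^∞}(E_F/F)` under the subgroup model `modelIso : H¹(Γ_F, E_F[p^∞]) ≃ H¹(N, M)`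
(`selmerModel`); `T^G ⊆ T` the classes fixed by all `g_*` (`selmerModelInvariants`).

*Lemma 4.14.* `res : S → T^G` (restriction commutes with the conjugation action, inner
automorphisms acting trivially: `conjH1_resSubgroupH1`) has kernel killed by `d = (G : N)`
(`cor ∘ res = (G : N)`, `index_nsmul_eq_zero_of_resSubgroupH1_eq_zero`) and cokernel killed by
`d · B`: for `ξ ∈ T^G`, `res (cor ξ) = Σ_{G/N} g_* ξ = d ξ` (`resSubgroupH1_coresH1`, the
Clark–Sharif Lemma 15 form of `res ∘ cor = Nm`), and `res (cor ξ) ∈ T` forces `B · cor ξ ∈ S`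
with `B = localDegreeBound d` (`localDegreeBound_nsmul_mem_selmerGroupPInfty_of_res_mem`: the
local conditions descend up to a bound depending only on `[F : K]`). Hence
`corank S = corank T^G` (`zpCorank_eq_of_nsmul_ker_of_nsmul_coker`), the `p`-torsion of
`p^∞`-Selmer groups being finite (`finite_torsionBy_selmerGroupPInfty`).

*Cor. 4.15, `d = p` odd.* Fix `σ₀ ≠ 1` in `Gal(F/K)` and its transported lift
`c = liftToAbsGal F σ₀ ∈ G ∖ N`; `c^p ∈ N`.
1. `T` is stable under `c_*` (`conjH1_liftToAbsGal_mem_selmerModel`: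
   `c_* ∘ modelIso = modelIso ∘ τ₀_*` by `RelModel.modelIso_relConjH1Primary`, and
   `Sel_{p^∞}(E_F/F)` is `Aut(F/K)`-stable for `p` odd, `relConjH1Primary_mem_selmerGroupPInfty`),
   and `(c_*)^p = (c^p)_* = 1` on `H¹(N, M)`. So `c_*` restricts to `σ ∈ End(T)` with `σ^p = 1`,
   and by the tree's `exists_zpCorank_eq_zpCorank_fixedSub_add` (file
   `ZpCorankCyclotomicDivisibility`: the module-theoretic shadow of "only two `ℚ_p`-irreducible
   representations of `C_p`") `corank T = corank T^σ + (p - 1) k`.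
2. `T^σ = T^G`: a class fixed by `c_*` is fixed by every `g_*`, `g ∈ G = ⋃ cⁱ N`
   (`conjH1_eq_self_of_forall_pow`). So `corank T^σ = rk_p(E/K)` by Lemma 4.14.
3. `corank T = corank Sel_{p^∞}(E_F/F) = rk_p(E/F)` (`modelIso`).

Everything here is proved; no named fact is introduced.

## References

* T. Dokchitser, V. Dokchitser, *On the Birch–Swinnerton-Dyer quotients modulo squares*, Ann. of
  Math. 172 (2010), 567–596 = arXiv:math/0610290: Lemma 4.14, Cor. 4.15 (arXiv Lemma 47,
  Cor. 48), §4.6 proof of Thm. 4.19. [DokchitserDokchitserAnnals2010]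
* P. L. Clark, S. Sharif, *Period, index and potential Ш*, Algebra & Number Theory 4 (2010),
  Lemma 15 (`res ∘ cores = Nm`). [ClarkSharif2010]
* J.-P. Serre, *Galois Cohomology* (1997), I.§2.4 (Prop. 9), I.§2.5. [SerreGaloisCohomology1997]
-/

noncomputable section

open scoped Classical AddSubgroup

namespace Literature.NumberTheory.EllipticCurves

open GaloisRepresentations WeierstrassCurve

/-! ## Generic: conjugation by powers, and by a group generated by one coset -/

section Generic

universe u

variable {G : Type u} [Group G] [TopologicalSpace G] [IsTopologicalGroup G]
variable (N : Subgroup G) [N.Normal]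
variable (M : Type u) [AddCommGroup M] [DistribMulAction G M] [TopologicalSpace M]
  [DiscreteTopology M]

/-- The conjugation action `c_*` on `H¹(N, M)` as an element of the endomorphism ring
`AddMonoid.End (H¹(N, M))` (the tree's `conjH1 N M c`, retyped so that powers make sense).
[folklore] -/
def conjEnd (c : G) : AddMonoid.End (subgroupH1 N M) := conjH1 N M c

/-- `conjEnd` is `conjH1` (definitional). [folklore] -/
@[simp]
theorem conjEnd_apply (c : G) (ξ : subgroupH1 N M) : conjEnd N M c ξ = conjH1 N M c ξ := rfl

/-- `(c^n)_* = (c_*)^n` on `H¹(N, M)` (`conjH1_mul`, `conjH1_one`). [folklore] -/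
theorem conjEnd_pow (c : G) (n : ℕ) : conjEnd N M (c ^ n) = conjEnd N M c ^ n := by
  induction n with
  | zero =>
    rw [pow_zero, pow_zero]
    exact conjH1_one_holds N M
  | succ n ih =>
    rw [pow_succ, pow_succ, ← ih]
    exact conjH1_mul_holds N M (c ^ n) c

/-- For `c^n ∈ N`, `(c_*)^n = 1` on `H¹(N, M)` (inner automorphisms act trivially,
`conjH1_of_mem`). Serre, *Galois Cohomology*, I.§2.5. [folklore] -/
theorem conjEnd_pow_eq_one {c : G} {n : ℕ} (h : c ^ n ∈ N) : conjEnd N M c ^ n = 1 := by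
  rw [← conjEnd_pow]
  exact conjH1_of_mem_holds N M h

/-- If `c_* ξ = ξ` then `(c^n)_* ξ = ξ`. [folklore] -/
theorem conjH1_pow_apply_eq_self {c : G} {ξ : subgroupH1 N M} (h : conjH1 N M c ξ = ξ) (n : ℕ) :
    conjH1 N M (c ^ n) ξ = ξ := by
  induction n with
  | zero =>
    rw [pow_zero, conjH1_one_holds N M]
    rfl
  | succ n ih =>
    rw [pow_succ, conjH1_mul_holds N M, AddMonoidHom.comp_apply, h, ih]

/-- **If `G = ⋃ cⁱ N` then a class fixed by `c_*` is fixed by every `g_*`**: for `N` normal of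
prime index `p` and `c ∉ N`, the quotient `G/N` (of prime order) is generated by `c N`
(`mem_powers_of_prime_card`), every `g ∈ G` is `cⁱ n` with `n ∈ N`, and inner automorphisms
from `N` act trivially on `H¹(N, M)` (`conjH1_of_mem`). Serre, *Galois Cohomology*, I.§2.5.
[folklore] -/
theorem conjH1_eq_self_of_forall_pow {p : ℕ} [Fact p.Prime] [N.FiniteIndex] (hidx : N.index = p)
    {c : G} (hc : c ∉ N) {ξ : subgroupH1 N M} (h : conjH1 N M c ξ = ξ) (g : G) :
    conjH1 N M g ξ = ξ := by
  have hcard : Nat.card (G ⧸ N) = p := by rw [← Subgroup.index, hidx]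
  have hc1 : (c : G ⧸ N) ≠ 1 := fun h1 ↦ hc ((QuotientGroup.eq_one_iff c).mp h1)
  obtain ⟨i, hi⟩ := (Submonoid.mem_powers_iff _ _).mp
    (mem_powers_of_prime_card hcard hc1 (g' := (g : G ⧸ N)))
  rw [← QuotientGroup.mk_pow] at hi
  have hn : (c ^ i)⁻¹ * g ∈ N := QuotientGroup.eq.mp hi
  have hg : g = c ^ i * ((c ^ i)⁻¹ * g) := (mul_inv_cancel_left _ _).symm
  rw [hg, conjH1_mul_holds N M, AddMonoidHom.comp_apply, conjH1_of_mem_holds N M hn,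
    AddMonoidHom.id_apply]
  exact conjH1_pow_apply_eq_self N M h i

end Generic

/-! ## Restricting an endomorphism to a stable subgroup -/

section RestrictEnd

variable {X : Type*} [AddCommGroup X]

/-- The restriction of an endomorphism `φ` of `X` to a `φ`-stable subgroup `T`, as an element of
`AddMonoid.End T`. [folklore] -/
def restrictEnd (φ : AddMonoid.End X) (T : AddSubgroup X) (h : ∀ x ∈ T, φ x ∈ T) :
    AddMonoid.End T :=
  AddMonoidHom.codRestrict (AddMonoidHom.comp φ T.subtype) T fun x ↦ h x x.2

/-- Values of `restrictEnd`. [folklore] -/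
@[simp]
theorem coe_restrictEnd_apply (φ : AddMonoid.End X) (T : AddSubgroup X) (h : ∀ x ∈ T, φ x ∈ T)
    (x : T) : ((restrictEnd φ T h x : T) : X) = φ x :=
  rfl

/-- Powers of `restrictEnd` are the restrictions of the powers. [folklore] -/
theorem coe_restrictEnd_pow_apply (φ : AddMonoid.End X) (T : AddSubgroup X)
    (h : ∀ x ∈ T, φ x ∈ T) (n : ℕ) (x : T) :
    ((restrictEnd φ T h ^ n) x : X) = (φ ^ n) x := by
  induction n generalizing x with
  | zero => rfl
  | succ n ih =>
    rw [pow_succ, pow_succ, AddMonoid.End.coe_mul, AddMonoid.End.coe_mul, Function.comp_apply,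
      Function.comp_apply, ih]
    rfl

/-- If `φ^n = 1` then `(restrictEnd φ)^n = 1`. [folklore] -/
theorem restrictEnd_pow_eq_one (φ : AddMonoid.End X) (T : AddSubgroup X) (h : ∀ x ∈ T, φ x ∈ T)
    {n : ℕ} (hφ : φ ^ n = 1) : restrictEnd φ T h ^ n = 1 := by
  refine DFunLike.ext _ _ fun x ↦ Subtype.ext ?_
  rw [coe_restrictEnd_pow_apply, hφ]
  rfl

end RestrictEnd

/-! ## The model `T ⊆ H¹(galRange F, E[p^∞])` of `Sel_{p^∞}(E_F/F)` -/

section Model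

variable {K : Type} [Field K] [NumberField K] (W : WeierstrassCurve K)
variable (F : Type) [Field F] [NumberField F] [Algebra K F] (p : ℕ)

/-- `T`: the image of `Sel_{p^∞}(E_F/F) ⊆ H¹(Γ_F, E_F[p^∞])` in `H¹(galRange F, E[p^∞])` under the
subgroup model `modelIso` (file `SelmerPInftyRestriction`). Dokchitser–Dokchitser 2010, proof of
Lemma 4.14 (`Sel_{p^∞}(E/F)` viewed inside `H¹(F, E[p^∞])`, `E[p^∞] = E[p^∞](K̄)`). [folklore] -/
def selmerModel : AddSubgroup (subgroupH1 (galRange (K := K) F) (geomPrimaryTorsion W p)) :=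
  (selmerGroupPInfty (W.baseChange F) p).map
    (modelIso F W p : galH1Primary (W.baseChange F) p →+
      subgroupH1 (galRange (K := K) F) (geomPrimaryTorsion W p))

/-- Membership in `T`: `ξ ∈ T ↔ modelIso⁻¹ ξ ∈ Sel_{p^∞}(E_F/F)`. [folklore] -/
theorem mem_selmerModel_iff (ξ : subgroupH1 (galRange (K := K) F) (geomPrimaryTorsion W p)) :
    ξ ∈ selmerModel W F p ↔ (modelIso F W p).symm ξ ∈ selmerGroupPInfty (W.baseChange F) p := by
  constructor
  · rintro ⟨s, hs, rfl⟩
    rw [AddMonoidHom.coe_coe, AddEquiv.symm_apply_apply]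
    exact hs
  · intro h
    exact ⟨_, h, (modelIso F W p).apply_symm_apply ξ⟩

/-- `Sel_{p^∞}(E_F/F) ≃ T` (restriction of `modelIso`). [folklore] -/
def selmerModelEquiv : selmerGroupPInfty (W.baseChange F) p ≃+ selmerModel W F p :=
  (modelIso F W p).addSubgroupMap (selmerGroupPInfty (W.baseChange F) p)

/-- **Restriction maps `Sel_{p^∞}(E/K)` into `T`** (`resPrimary` maps Selmer to Selmer, and is
the plain restriction to `galRange F` under the model, `modelIso_resPrimary`).
Dokchitser–Dokchitser 2010, proof of Lemma 4.14. [folklore] -/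
theorem resSubgroupH1_mem_selmerModel {x : galH1Primary W p} (hx : x ∈ selmerGroupPInfty W p) :
    resSubgroupH1 (galRange (K := K) F) (geomPrimaryTorsion W p) x ∈ selmerModel W F p :=
  ⟨resPrimary W F p x, resPrimary_mem_selmerGroupPInfty W F p hx, modelIso_resPrimary F W p x⟩

/-- If `res η ∈ T` then `modelIso⁻¹`-transport: `resPrimary η ∈ Sel_{p^∞}(E_F/F)`. [folklore] -/
theorem resPrimary_mem_of_resSubgroupH1_mem {η : galH1Primary W p}
    (h : resSubgroupH1 (galRange (K := K) F) (geomPrimaryTorsion W p) η ∈ selmerModel W F p) :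
    resPrimary W F p η ∈ selmerGroupPInfty (W.baseChange F) p := by
  rw [mem_selmerModel_iff] at h
  have e : resSubgroupH1 (galRange (K := K) F) (geomPrimaryTorsion W p) η =
      modelIso F W p (resPrimary W F p η) := (modelIso_resPrimary F W p η).symm
  rw [e, AddEquiv.symm_apply_apply] at h
  exact h

variable [IsGalois K F]

/-- `T^G`: the classes of `T` fixed by the conjugation action `g_*` of every `g ∈ Γ_K` on
`H¹(galRange F, E[p^∞])` (normal subgroup, `RelModel.normal_galRange`) — the model of
`Sel_{p^∞}(E/F)^G`, `G = Gal(F/K)` (the action of `Γ_K` factors through `G`, `conjH1_of_mem`).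
Dokchitser–Dokchitser 2010, Lemma 4.14 (`X_p(E/F)^G`). [cite: DokchitserDokchitserAnnals2010, Lemma 4.14] -/
def selmerModelInvariants : AddSubgroup (subgroupH1 (galRange (K := K) F) (geomPrimaryTorsion W p)) :=
  haveI := RelModel.normal_galRange (K := K) F
  { carrier := {ξ | ξ ∈ selmerModel W F p ∧ ∀ g : Field.absoluteGaloisGroup K,
      conjH1 (galRange (K := K) F) (geomPrimaryTorsion W p) g ξ = ξ}
    add_mem' := fun {a b} ha hb ↦ ⟨(selmerModel W F p).add_mem ha.1 hb.1, fun g ↦ by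
      rw [map_add, ha.2 g, hb.2 g]⟩
    zero_mem' := ⟨(selmerModel W F p).zero_mem, fun g ↦ map_zero _⟩
    neg_mem' := fun {a} ha ↦ ⟨(selmerModel W F p).neg_mem ha.1, fun g ↦ by rw [map_neg, ha.2 g]⟩ }

/-- Membership in `T^G`. [folklore] -/
theorem mem_selmerModelInvariants_iff (ξ : subgroupH1 (galRange (K := K) F) (geomPrimaryTorsion W p)) :
    haveI := RelModel.normal_galRange (K := K) F
    ξ ∈ selmerModelInvariants W F p ↔ ξ ∈ selmerModel W F p ∧
      ∀ g : Field.absoluteGaloisGroup K,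
        conjH1 (galRange (K := K) F) (geomPrimaryTorsion W p) g ξ = ξ :=
  Iff.rfl

/-- `T^G ≤ T`. [folklore] -/
theorem selmerModelInvariants_le : selmerModelInvariants W F p ≤ selmerModel W F p :=
  fun _ h ↦ h.1

variable [Fact p.Prime]

/-- **`T` is stable under the conjugation action of the transported lifts** `c = liftToAbsGal F σ₀`
(`p` odd): `c_* (modelIso s) = modelIso (τ₀_* s)` (`RelModel.modelIso_relConjH1Primary`) and
`Sel_{p^∞}(E_F/F)` is `Aut(F/K)`-stable (`relConjH1Primary_mem_selmerGroupPInfty`).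
Dokchitser–Dokchitser 2010, Lemma 4.14 (`Sel_{p^∞}(E/F)` as a `G`-module).
[cite: DokchitserDokchitserAnnals2010, Lemma 4.14] -/
theorem conjH1_liftToAbsGal_mem_selmerModel (hp : p ≠ 2) (σ₀ : F ≃ₐ[K] F)
    {ξ : subgroupH1 (galRange (K := K) F) (geomPrimaryTorsion W p)} (hξ : ξ ∈ selmerModel W F p) :
    haveI := RelModel.normal_galRange (K := K) F
    conjH1 (galRange (K := K) F) (geomPrimaryTorsion W p) (liftToAbsGal (K := K) F σ₀) ξ ∈
      selmerModel W F p := by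
  haveI := RelModel.normal_galRange (K := K) F
  obtain ⟨s, hs, rfl⟩ := hξ
  refine ⟨(isLiftOfAut_liftAut σ₀).relConjH1Primary W p s,
    relConjH1Primary_mem_selmerGroupPInfty W p hp (isLiftOfAut_liftAut σ₀) hs, ?_⟩
  exact RelModel.modelIso_relConjH1Primary F W p σ₀ s

/-- **`T` is stable under the conjugation action of every `g ∈ Γ_K`** (`p` odd, `F/K` finite
Galois): `g = c_{σ₀} n` with `n ∈ galRange F` (`RelModel.exists_liftToAbsGal_inv_mul_mem_galRange`),
`n_*` is the identity (`conjH1_of_mem`) and `c_{σ₀ *}` preserves `T`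
(`conjH1_liftToAbsGal_mem_selmerModel`). This is the `Gal(F/K)`-module structure on
`Sel_{p^∞}(E/F)` of Dokchitser–Dokchitser 2010, Lemma 4.14 and §4.6 (`X = X_p(E/F)` decomposed
under `Gal(F/K)`), in the model. [cite: DokchitserDokchitserAnnals2010, Lemma 4.14] -/
theorem conjH1_mem_selmerModel (hp : p ≠ 2) (g : Field.absoluteGaloisGroup K)
    {ξ : subgroupH1 (galRange (K := K) F) (geomPrimaryTorsion W p)} (hξ : ξ ∈ selmerModel W F p) :
    haveI := RelModel.normal_galRange (K := K) F
    conjH1 (galRange (K := K) F) (geomPrimaryTorsion W p) g ξ ∈ selmerModel W F p := by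
  haveI := RelModel.normal_galRange (K := K) F
  obtain ⟨σ₀, hn⟩ := RelModel.exists_liftToAbsGal_inv_mul_mem_galRange (K := K) F g
  have hg : g = liftToAbsGal (K := K) F σ₀ * ((liftToAbsGal (K := K) F σ₀)⁻¹ * g) :=
    (mul_inv_cancel_left _ _).symm
  rw [hg, conjH1_mul_holds _ _, AddMonoidHom.comp_apply, conjH1_of_mem_holds _ _ hn,
    AddMonoidHom.id_apply]
  exact conjH1_liftToAbsGal_mem_selmerModel W F p hp σ₀ hξ

end Model

/-! ## Lemma 4.14: `rk_p(E/K) = corank (T^G)` for `F/K` finite Galois -/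

section Lemma414

variable {K : Type} [Field K] [NumberField K] (W : WeierstrassCurve K) [W.IsElliptic]
variable (F : Type) [Field F] [NumberField F] [Algebra K F] [IsGalois K F]
variable (p : ℕ) [Fact p.Prime]

omit [W.IsElliptic] [IsGalois K F] [Fact p.Prime] in
/-- `T ≅ Sel_{p^∞}(E_F/F)` is `p`-primary. [folklore] -/
theorem exists_pow_nsmul_eq_zero_selmerModel (t : selmerModel W F p) : ∃ n : ℕ, p ^ n • t = 0 := by
  let e : selmerGroupPInfty (W.baseChange F) p ≃+ selmerModel W F p := selmerModelEquiv W F p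
  obtain ⟨n, hn⟩ := exists_pow_nsmul_eq_zero_galH1Primary (W.baseChange F) p ((e.symm t : _) : _)
  refine ⟨n, ?_⟩
  have : p ^ n • e.symm t = 0 := Subtype.ext (by rw [AddSubmonoidClass.coe_nsmul]; exact hn)
  simpa using congrArg e this

omit [IsGalois K F] in
/-- `T ≅ Sel_{p^∞}(E_F/F)` has finite `p`-torsion (`finite_torsionBy_selmerGroupPInfty`).
[folklore] -/
theorem finite_torsionBy_selmerModel : Finite (selmerModel W F p)[(p : ℤ)] := by
  haveI : Finite (selmerGroupPInfty (W.baseChange F) p)[(p : ℤ)] :=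
    finite_torsionBy_selmerGroupPInfty (W.baseChange F) p
  exact Finite.of_equiv _ (torsionByEquiv (selmerModelEquiv W F p) p).toEquiv

/-- **Dokchitser–Dokchitser 2010, Lemma 4.14** (p. 23; arXiv Lemma 47): "Let `E/K` be an elliptic
curve, and let `F/K` be a finite Galois extension with Galois group `G`. Then
`rk_p(E/K) = dim_{ℚ_p} X_p(E/F)^G`" — on the Selmer side: `rk_p(E/K) = corank_{ℤ_p} (T^G)` for
the model `T ≅ Sel_{p^∞}(E_F/F)` inside `H¹(Gal(K̄/F), E[p^∞])` and its `Γ_K`-invariants `T^G`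
(`selmerModelInvariants`; `X_p = Hom(−, ℚ_p/ℤ_p) ⊗ ℚ_p` turns coranks into dimensions and
invariants into coinvariants of the same dimension). Printed proof: restriction
`Sel_{p^∞}(E/K) → Sel_{p^∞}(E/F)^G` has kernel and cokernel killed by `|G|²`; here the kernel is
killed by `|G| = (Γ_K : N)` (`cor ∘ res`) and the cokernel by `|G| · B(|G|)` (`res ∘ cor = Nm` on
`G`-invariants, then descent of the local conditions, `localDegreeBound`), which suffices.
[cite: DokchitserDokchitserAnnals2010, Lemma 4.14] -/
theorem selmerCorank_eq_zpCorank_selmerModelInvariants :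
    W.selmerCorank p = zpCorank (selmerModelInvariants W F p) p := by
  -- notation and instances
  set N : Subgroup (Field.absoluteGaloisGroup K) := galRange (K := K) F with hNdef
  haveI hNn : N.Normal := RelModel.normal_galRange (K := K) F
  haveI hNf : N.FiniteIndex := RelModel.finiteIndex_galRange (K := K) F
  letI : Fintype (Field.absoluteGaloisGroup K ⧸ N) := Fintype.ofFinite _
  have hNo : IsOpen (N : Set (Field.absoluteGaloisGroup K)) := isOpen_galRange F
  haveI : FiniteDimensional K F := Module.Finite.of_restrictScalars_finite ℚ K F
  set d : ℕ := Module.finrank K F with hddef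
  have hidx : N.index = d := RelModel.index_galRange (K := K) F
  have hd : d ≠ 0 := Module.finrank_pos.ne'
  have hM : ∀ m : geomPrimaryTorsion W p, Continuous fun g : Field.absoluteGaloisGroup K ↦ g • m :=
    continuous_smul_geomPrimaryTorsion W p
  set X := subgroupH1 N (geomPrimaryTorsion W p) with hXdef
  set T : AddSubgroup X := selmerModel W F p with hTdef
  set TG : AddSubgroup X := selmerModelInvariants W F p with hTGdef
  set S : AddSubgroup (galH1Primary W p) := selmerGroupPInfty W p with hSdef
  -- `p`-primary, finite `p`-torsion
  have hTprim : ∀ t : T, ∃ n : ℕ, p ^ n • t = 0 := exists_pow_nsmul_eq_zero_selmerModel W F p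
  haveI hTfin : Finite T[(p : ℤ)] := finite_torsionBy_selmerModel W F p
  have hle : TG ≤ T := selmerModelInvariants_le W F p
  obtain ⟨hTGprim, hTGfin⟩ := primary_and_finite_torsionBy_of_injective
    (i := AddSubgroup.inclusion hle) (AddSubgroup.inclusion_injective hle) hTprim
  haveI := hTGfin
  have hSprim : ∀ s : S, ∃ n : ℕ, p ^ n • s = 0 := fun s ↦ by
    obtain ⟨n, hn⟩ := exists_pow_nsmul_eq_zero_galH1Primary W p (s : galH1Primary W p)
    exact ⟨n, Subtype.ext (by rw [AddSubmonoidClass.coe_nsmul]; exact hn)⟩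
  haveI hSfin : Finite S[(p : ℤ)] := finite_torsionBy_selmerGroupPInfty W p
  -- `res : S → T^G`
  have hresT : ∀ s : S, resSubgroupH1 N (geomPrimaryTorsion W p) (s : galH1Primary W p) ∈ T :=
    fun s ↦ resSubgroupH1_mem_selmerModel W F p s.2
  let f : S →+ TG := ((resSubgroupH1 N (geomPrimaryTorsion W p)).comp S.subtype).codRestrict TG
    fun s ↦ ⟨hresT s, fun g ↦ conjH1_resSubgroupH1 N hM g _⟩
  have hfcoe : ∀ s : S, ((f s : TG) : X) =
      resSubgroupH1 N (geomPrimaryTorsion W p) (s : galH1Primary W p) := fun _ ↦ rfl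
  -- the bound
  set B : ℕ := localDegreeBound d with hBdef
  have hB : B ≠ 0 := localDegreeBound_ne_zero d
  have hdB : d * B ≠ 0 := mul_ne_zero hd hB
  -- kernel killed by `d`, hence by `d * B`
  have hker : ∀ s : S, f s = 0 → (d * B) • s = 0 := by
    intro s hs
    have h0 : resSubgroupH1 N (geomPrimaryTorsion W p) (s : galH1Primary W p) = 0 := by
      rw [← hfcoe, hs]; rfl
    have h1 := index_nsmul_eq_zero_of_resSubgroupH1_eq_zero N hNo h0
    rw [hidx] at h1
    apply Subtype.ext
    rw [AddSubmonoidClass.coe_nsmul, mul_nsmul, h1, nsmul_zero, ZeroMemClass.coe_zero]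
  -- cokernel killed by `d * B`
  have hcoker : ∀ y : TG, (d * B) • y ∈ f.range := by
    intro y
    set ξ : X := (y : X) with hξdef
    have hξT : ξ ∈ T := y.2.1
    have hξall : ∀ g : Field.absoluteGaloisGroup K, conjH1 N (geomPrimaryTorsion W p) g ξ = ξ :=
      y.2.2
    -- `η = cor ξ` and `res η = d ξ`
    set η : galH1Primary W p := coresH1 N hNo ξ with hηdef
    have hresη : resSubgroupH1 N (geomPrimaryTorsion W p) η = d • ξ := by
      rw [hηdef, resSubgroupH1_coresH1 N hNo (s := Quotient.out) (fun x ↦ QuotientGroup.out_eq' x) ξ]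
      calc ∑ x : Field.absoluteGaloisGroup K ⧸ N,
            conjH1 N (geomPrimaryTorsion W p) (Quotient.out x) ξ
          = ∑ _x : Field.absoluteGaloisGroup K ⧸ N, ξ := Finset.sum_congr rfl fun x _ ↦ hξall _
        _ = d • ξ := by
          rw [Finset.sum_const, Finset.card_univ, ← Nat.card_eq_fintype_card, ← Subgroup.index,
            hidx]
    -- `res η ∈ T`, so `B η ∈ S`
    have hresηT : resSubgroupH1 N (geomPrimaryTorsion W p) η ∈ T := by
      rw [hresη]; exact T.nsmul_mem hξT d
    have hBη : B • η ∈ S :=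
      localDegreeBound_nsmul_mem_selmerGroupPInfty_of_res_mem W F hddef.symm.le p (resPrimary W F p)
        (primaryH1ToH1_resPrimary W F p) (resPrimary_mem_of_resSubgroupH1_mem W F p hresηT)
    refine ⟨⟨B • η, hBη⟩, ?_⟩
    apply Subtype.ext
    rw [hfcoe]
    change resSubgroupH1 N (geomPrimaryTorsion W p) (B • η) = (((d * B) • y : TG) : X)
    rw [map_nsmul, hresη, AddSubmonoidClass.coe_nsmul, ← hξdef, mul_nsmul]
  -- conclude
  exact zpCorank_eq_of_nsmul_ker_of_nsmul_coker f hSprim hTGprim hdB hker hcoker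

end Lemma414

/-! ## Cor. 4.15: `rk_p(E/F) = rk_p(E/K) + (p - 1) k` for `F/K` Galois of degree `p` -/

section PrimeDegree

variable {K : Type} [Field K] [NumberField K] (W : WeierstrassCurve K) [W.IsElliptic]
variable (F : Type) [Field F] [NumberField F] [Algebra K F] [IsGalois K F]
variable (p : ℕ) [Fact p.Prime]

/-- **`rk_p(E/F) - rk_p(E/K)` is a multiple of `p - 1`** for an elliptic curve `E/K` over a number
field, an odd prime `p` and a Galois extension `F/K` of degree `p` (Dokchitser–Dokchitser 2010,
proof of Cor. 4.15: `rk_p(E/K) = dim X_p(E/F)^G` by Lemma 4.14, and "a cyclic group of order `p`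
has only two `ℚ_p`-irreducible `p`-adic representations, the trivial one and one of dimension
`p - 1`"). See the module docstring for the proof on the Selmer side (`T`, `T^σ = T^G`).
[cite: DokchitserDokchitserAnnals2010, Cor. 4.15 (proof) and Lemma 4.14] -/
theorem exists_selmerCorank_baseChange_eq_add_of_prime_degree (hp : p ≠ 2)
    (hF : Module.finrank K F = p) :
    ∃ k : ℕ, (W.baseChange F).selmerCorank p = W.selmerCorank p + (p - 1) * k := by
  -- notation and instances
  set N : Subgroup (Field.absoluteGaloisGroup K) := galRange (K := K) F with hNdef
  haveI hNn : N.Normal := RelModel.normal_galRange (K := K) F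
  haveI hNf : N.FiniteIndex := RelModel.finiteIndex_galRange (K := K) F
  have hidx : N.index = p := (RelModel.index_galRange (K := K) F).trans hF
  -- a non-trivial element of `Gal(F/K)` and its transported lift `c`
  haveI : FiniteDimensional K F := Module.Finite.of_restrictScalars_finite ℚ K F
  obtain ⟨σ₀, hσ₀⟩ : ∃ σ₀ : F ≃ₐ[K] F, σ₀ ≠ 1 := by
    have hcard : 1 < Nat.card (F ≃ₐ[K] F) := by
      rw [IsGalois.card_aut_eq_finrank K F, hF]
      exact (Fact.out : p.Prime).one_lt
    obtain ⟨a, b, hab⟩ := Finite.one_lt_card_iff_nontrivial.mp hcard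
    by_cases ha : a = 1
    · exact ⟨b, fun hb ↦ hab (ha.trans hb.symm)⟩
    · exact ⟨a, ha⟩
  set c : Field.absoluteGaloisGroup K := liftToAbsGal (K := K) F σ₀ with hcdef
  have hcN : c ∉ N := liftToAbsGal_not_mem F hσ₀
  have hcp : c ^ p ∈ N := hF ▸ RelModel.pow_finrank_mem_galRange (K := K) F c
  -- the groups
  set X := subgroupH1 N (geomPrimaryTorsion W p) with hXdef
  set T : AddSubgroup X := selmerModel W F p with hTdef
  set TG : AddSubgroup X := selmerModelInvariants W F p with hTGdef
  -- step 1: `σ = c_*|_T`, `σ^p = 1`, `corank T = corank T^σ + (p-1) k`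
  set φ : AddMonoid.End X := conjEnd N (geomPrimaryTorsion W p) c with hφdef
  have hφT : ∀ x ∈ T, φ x ∈ T := fun x hx ↦ conjH1_liftToAbsGal_mem_selmerModel W F p hp σ₀ hx
  have hφp : φ ^ p = 1 := conjEnd_pow_eq_one N (geomPrimaryTorsion W p) hcp
  set σ : AddMonoid.End T := restrictEnd φ T hφT with hσdef
  have hσp : σ ^ p = 1 := restrictEnd_pow_eq_one φ T hφT hφp
  have hTprim : ∀ t : T, ∃ n : ℕ, p ^ n • t = 0 := exists_pow_nsmul_eq_zero_selmerModel W F p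
  haveI hTfin : Finite T[(p : ℤ)] := finite_torsionBy_selmerModel W F p
  obtain ⟨k, hk⟩ := exists_zpCorank_eq_zpCorank_fixedSub_add (p := p) hσp hTprim
  -- step 2: `T^σ = T^G`
  have hall : ∀ t : fixedSub σ, ∀ g : Field.absoluteGaloisGroup K,
      conjH1 N (geomPrimaryTorsion W p) g ((t : T) : X) = ((t : T) : X) := fun t ↦ by
    have hc : φ ((t : T) : X) = ((t : T) : X) :=
      congrArg Subtype.val ((mem_fixedSub_iff σ (t : T)).mp t.2)
    exact conjH1_eq_self_of_forall_pow N (geomPrimaryTorsion W p) hidx hcN hc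
  let eFix : fixedSub σ ≃+ TG :=
    { toFun := fun t ↦ ⟨((t : T) : X), (t : T).2, hall t⟩
      invFun := fun y ↦ ⟨⟨(y : X), y.2.1⟩, (mem_fixedSub_iff σ _).mpr (Subtype.ext (y.2.2 c))⟩
      left_inv := fun t ↦ Subtype.ext (Subtype.ext rfl)
      right_inv := fun y ↦ Subtype.ext rfl
      map_add' := fun _ _ ↦ Subtype.ext rfl }
  have hfix : zpCorank (fixedSub σ) p = W.selmerCorank p := by
    rw [zpCorank_congr eFix p]
    exact (selmerCorank_eq_zpCorank_selmerModelInvariants W F p).symm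
  -- step 3: assemble
  refine ⟨k, ?_⟩
  have hTF : (W.baseChange F).selmerCorank p = zpCorank T p :=
    zpCorank_congr (selmerModelEquiv W F p) p
  rw [hTF, hk, hfix]

/-- **Dokchitser–Dokchitser 2010, Cor. 4.15** (p. 24; arXiv Cor. 48): "The parity of the
`p^∞`-Selmer rank i[s] unchanged in cyclic `p`-extensions" — in the degree-`p` form proved there
("Thus," after Lemma 4.14 and the two `ℚ_p`-irreducible representations of `C_p`): for an elliptic
curve `E` over a number field `K`, an odd prime `p` and a Galois extension `F/K` of degree `p`,
`rk_p(E/F) ≡ rk_p(E/K) (mod 2)`. This is verbatim the hypothesis `h415` of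
`dokchitser_selmerCorank_baseChange_mod_two_eq_of_printed`.
[cite: DokchitserDokchitserAnnals2010, Cor. 4.15] -/
theorem selmerCorank_baseChange_mod_two_eq_of_prime_degree (hp : p ≠ 2)
    (hF : Module.finrank K F = p) :
    (W.baseChange F).selmerCorank p % 2 = W.selmerCorank p % 2 := by
  obtain ⟨k, hk⟩ := exists_selmerCorank_baseChange_eq_add_of_prime_degree W F p hp hF
  have hodd : Odd p := (Fact.out : p.Prime).odd_of_ne_two hp
  obtain ⟨m, hm⟩ := hodd
  rw [hk, hm, show 2 * m + 1 - 1 = 2 * m by omega, mul_assoc, Nat.add_mul_mod_self_left]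

end PrimeDegree

/-! ## Cor. 4.15 as printed: cyclic Galois extensions of degree `p^(n+1)` -/

section CyclicPPower

open IntermediateField

/-- An intermediate field of a finite extension of a number field is a number field. [folklore] -/
theorem numberField_intermediateField {K : Type} [Field K] [NumberField K] {F : Type} [Field F]
    [NumberField F] [Algebra K F] (F₁ : IntermediateField K F) : NumberField F₁ :=
  haveI : FiniteDimensional K F := Module.Finite.of_restrictScalars_finite ℚ K F
  { to_charZero := inferInstance
    to_finiteDimensional := Module.Finite.trans K F₁ }

/-- **Dokchitser–Dokchitser 2010, Cor. 4.15** (p. 24; arXiv Cor. 48), as printed: "The parity of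
the `p^∞`-Selmer rank i[s] unchanged in cyclic `p`-extensions": for an elliptic curve `E` over a
number field `K`, an odd prime `p` and a Galois extension `F/K` with cyclic Galois group of order
`p^(n+1)`, `rk_p(E/F) ≡ rk_p(E/K) (mod 2)`. By induction on `n` from the degree-`p` case
(`selmerCorank_baseChange_mod_two_eq_of_prime_degree`) along `K ⊂ F₁ = F^H ⊂ F`, `|H| = p^n`
(see the module docstring). [cite: DokchitserDokchitserAnnals2010, Cor. 4.15] -/
theorem selmerCorank_baseChange_mod_two_eq_of_isCyclic (n : ℕ) :
    ∀ (K : Type) [Field K] [NumberField K] (W : WeierstrassCurve K) [W.IsElliptic]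
      (F : Type) [Field F] [NumberField F] [Algebra K F] [IsGalois K F] (p : ℕ) [Fact p.Prime],
        p ≠ 2 → IsCyclic (F ≃ₐ[K] F) → Module.finrank K F = p ^ (n + 1) →
          (W.baseChange F).selmerCorank p % 2 = W.selmerCorank p % 2 := by
  induction n with
  | zero =>
    intro K _ _ W _ F _ _ _ _ p _ hp _ hF
    rw [zero_add, pow_one] at hF
    exact selmerCorank_baseChange_mod_two_eq_of_prime_degree W F p hp hF
  | succ n ih =>
    intro K _ _ W _ F _ _ _ _ p _ hp hcyc hF
    haveI : FiniteDimensional K F := Module.Finite.of_restrictScalars_finite ℚ K F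
    have hprime : (p : ℕ).Prime := Fact.out
    -- the subgroup `H` of order `p^(n+1)` and its fixed field `F₁`
    have hcard : Nat.card (F ≃ₐ[K] F) = p ^ (n + 2) := by
      rw [IsGalois.card_aut_eq_finrank K F, hF]
    obtain ⟨H, hH⟩ : ∃ H : Subgroup (F ≃ₐ[K] F), Nat.card H = p ^ (n + 1) :=
      Sylow.exists_subgroup_card_pow_prime p (hcard ▸ pow_dvd_pow p (Nat.le_succ _))
    set F₁ : IntermediateField K F := fixedField H with hF₁
    haveI : NumberField F₁ := numberField_intermediateField F₁
    -- degrees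
    have hdeg₁ : Module.finrank F₁ F = p ^ (n + 1) := by
      rw [hF₁, finrank_fixedField_eq_card, hH]
    have hdeg₀ : Module.finrank K F₁ = p := by
      have htower := Module.finrank_mul_finrank K F₁ F
      rw [hdeg₁, hF, pow_succ' p (n + 1)] at htower
      exact Nat.eq_of_mul_eq_mul_right (pow_pos hprime.pos _) htower
    -- `F/F₁` is cyclic Galois; `F₁/K` is Galois (all subgroups of the cyclic group are normal)
    haveI : IsGalois F₁ F := IsGalois.tower_top_of_isGalois K F₁ F
    have hcyc₁ : IsCyclic (F ≃ₐ[F₁] F) :=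
      (IntermediateField.subgroupEquivAlgEquiv H).isCyclic.mp inferInstance
    haveI : IsGalois K F₁ := IsGalois.of_fixedField_normal_subgroup H
    -- induction hypothesis over `F₁`, prime degree below `F₁`
    have htop := ih F₁ (W.baseChange F₁) F p hp hcyc₁ hdeg₁
    rw [baseChange_baseChange W F₁ F] at htop
    rw [htop]
    exact selmerCorank_baseChange_mod_two_eq_of_prime_degree W F₁ p hp hdeg₀

end CyclicPPower

/-! ## Step (4) of the proof of Thm. 4.19 from the two remaining printed inputs -/

section Assembly

/-- **Cor. 4.15 in the form `h415`** of `BSDSelmerParityDokchitserHeegnerFieldProofs` (all number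
fields `K`, elliptic `E/K`, Galois `F/K` of degree `p`, `p` odd), discharged by
`selmerCorank_baseChange_mod_two_eq_of_prime_degree`. [cite: DokchitserDokchitserAnnals2010, Cor. 4.15] -/
theorem forall_selmerCorank_baseChange_mod_two_eq_of_prime_degree :
    ∀ (K : Type) [Field K] [NumberField K] (W : WeierstrassCurve K) [W.IsElliptic]
      (F : Type) [Field F] [NumberField F] [Algebra K F] [IsGalois K F] (p : ℕ) [Fact p.Prime],
        p ≠ 2 → Module.finrank K F = p →
          (W.baseChange F).selmerCorank p % 2 = W.selmerCorank p % 2 :=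
  fun _ _ _ W _ F _ _ _ _ p _ hp hF ↦
    selmerCorank_baseChange_mod_two_eq_of_prime_degree W F p hp hF

/-- **Step (4) of the proof of Thm. 4.19 (= Thm. 1.4) of Dokchitser–Dokchitser 2010 — the named
fact `dokchitser_selmerCorank_baseChange_mod_two_eq` (`rk_p(E/M₀)` odd for `E/ℚ`, `p` odd, `M₀`
imaginary quadratic with all bad primes split) — from the two remaining printed inputs**: the
dihedral congruence `h417` ("`rk_p(E/M_n) + m_ρ` is even": Prop. 4.17 together with "`C(E/F)`
and `C(E/M)` are squares when all bad primes split in `M/K`", §4.6) and `hCV` ("`m_ρ = p^n` for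
`n` large": Cornut–Vatsal, Thm. 1.5/4.2 with Tian–Zhang / Nekovář, Thm. 3.2, §4.6), both typed
exactly as in `dokchitser_selmerCorank_baseChange_mod_two_eq_of_printed`; the other two inputs of
that reduction are now theorems: the anticyclotomic `ℤ_p`-extension
(`ZpExtension.exists_isAnticyclotomic_holds`) and Cor. 4.15 (`forall_selmerCorank_baseChange_mod_two_eq_of_prime_degree`, this file).
[cite: DokchitserDokchitserAnnals2010, §4.6, proof of Thm. 4.19 (= Thm. 1.4), pp. 26–27] -/
theorem dokchitser_selmerCorank_baseChange_mod_two_eq_of_h417_of_hCV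
    (h417 : ∀ (W : WeierstrassCurve ℚ) [W.IsElliptic] (p : ℕ) [Fact p.Prime], p ≠ 2 →
      ∀ (K : Type) [Field K] [NumberField K], IsImaginaryQuadratic K →
        SatisfiesHeegnerHypothesis (W.conductorNorm ℤ) K →
          ∀ (κ : ZpExtension K p), κ.IsAnticyclotomic → ∀ n : ℕ, ∃ mρ : ℕ,
            (W.baseChange (κ.layer (n + 1))).selmerCorank p =
                (W.baseChange (κ.layer n)).selmerCorank p + (p - 1) * mρ ∧
              Even ((W.baseChange (κ.layer n)).selmerCorank p + mρ))
    (hCV : ∀ (W : WeierstrassCurve ℚ) [W.IsElliptic] (p : ℕ) [Fact p.Prime], p ≠ 2 →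
      ∀ (K : Type) [Field K] [NumberField K], IsImaginaryQuadratic K →
        SatisfiesHeegnerHypothesis (W.conductorNorm ℤ) K →
          ∀ (κ : ZpExtension K p), κ.IsAnticyclotomic → ∃ n₀ : ℕ, ∀ n ≥ n₀,
            (W.baseChange (κ.layer (n + 1))).selmerCorank p =
              (W.baseChange (κ.layer n)).selmerCorank p + (p - 1) * p ^ n) :
    dokchitser_selmerCorank_baseChange_mod_two_eq :=
  dokchitser_selmerCorank_baseChange_mod_two_eq_of_printed
    (fun K _ _ p _ ↦ ZpExtension.exists_isAnticyclotomic_holds (K := K) (p := p))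
    forall_selmerCorank_baseChange_mod_two_eq_of_prime_degree h417 hCV

end Assembly

end Literature.NumberTheory.EllipticCurves
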